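import Literature.Probability.LatticeModels.SixVertexGFFHeight
import Literature.Probability.LatticeModels.SixVertexGFFInvariance

/-!
# Six-vertex model: lattice-translation invariance of the `k`-point functions
# (DKLM 2026, Def. 2.4 with Thm. 2.2)

H. Duminil-Copin, K. K. Kozlowski, P. Lammers, I. Manolescu, *Gaussian free field convergence of
the six-vertex model with `-1 ≤ Δ ≤ -1/2`*, arXiv:2603.06268 (2026) [DKLM2026SixVertexGFF]:
Theorem 2.2 states that the slope-zero measure `ℙ_{ℤ²}` is invariant under the automorphisms of
`ℤ²`, and the `k`-point functions `Φ_k(u) = 𝔼_{ℤ²}[∏ᵢ (h(uᵢ') - h(uᵢ))]` of Def. 2.4 only involve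
height *differences*; consequently `Φ_k(u + v) = Φ_k(u)` for every lattice vector `v ∈ ℤ²`
(used throughout the paper, e.g. in the spectral representation of §4.5 where only relative
positions `uᵢ' - uᵢ`, `u_{i+1} - uᵢ'` enter).

This file proves that statement for the objects of
`Literature/Probability/LatticeModels/SixVertexGFF.lean`, combining

* path independence of the height function of an ice configuration
  (`heightAt_sub_heightAt`, file `SixVertexGFFHeight.lean`), which gives the **translation
  covariance of the height function** `h_{ω(· + v)}(f) = h_ω(f + v) - h_ω(v)` (`heightAt_shift`);
* the `P`-almost sure ice rule and the translation invariance of `P`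
  (`IsPlanarSixVertexMeasure.ae_iceRuleAt`, `IsPlanarSixVertexMeasure.integral_shift_eq`, file
  `SixVertexGFFInvariance.lean`).

Main statement: `IsPlanarSixVertexMeasure.kPoint_add_latticeVector`.

## References

* H. Duminil-Copin, K. K. Kozlowski, P. Lammers, I. Manolescu, arXiv:2603.06268 (2026), Thm. 2.2,
  Def. 2.3, Def. 2.4. [DKLM2026SixVertexGFF]
-/

noncomputable section

open MeasureTheory Filter Topology ProbabilityTheory
open scoped NNReal BoundedContinuousFunction

namespace Literature.Probability.LatticeModels.SixVertex

/-- Re-indexing a signed interval sum by a translation. [folklore] -/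
theorem zsumIco_comp_add (f : ℤ → ℤ) (s a b : ℤ) :
    zsumIco (fun k => f (k + s)) a b = zsumIco f (a + s) (b + s) := by
  have h : ∀ c d : ℤ, ∑ k ∈ Finset.Ico c d, f (k + s) = ∑ k ∈ Finset.Ico (c + s) (d + s), f k := by
    intro c d
    rw [← Finset.map_add_right_Ico, Finset.sum_map]
    rfl
  unfold zsumIco
  by_cases hab : a ≤ b
  · rw [if_pos hab, if_pos (by omega), h]
  · rw [if_neg hab, if_neg (by omega), h]

/-- Eastward increments of a translated configuration. [folklore] -/
theorem eastStep_shift (ω : Config (ℤ × ℤ)) (v : ℤ × ℤ) (x y : ℤ) :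
    eastStep (fun w => ω (w + v)) x y = eastStep ω (x + v.1) (y + v.2) := by
  have e : (x + 1, y) + v = (x + v.1 + 1, y + v.2) :=
    Prod.ext (by simp only [Prod.fst_add]; ring) (by simp only [Prod.snd_add])
  simp only [eastStep, e]

/-- Northward increments of a translated configuration. [folklore] -/
theorem northStep_shift (ω : Config (ℤ × ℤ)) (v : ℤ × ℤ) (x y : ℤ) :
    northStep (fun w => ω (w + v)) x y = northStep ω (x + v.1) (y + v.2) := by
  have e : (x, y + 1) + v = (x + v.1, y + v.2 + 1) :=
    Prod.ext (by simp only [Prod.fst_add]) (by simp only [Prod.snd_add]; ring)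
  simp only [northStep, e]

/-- **Translation covariance of the height function of an ice configuration**:
`h_{ω(· + v)}(f) = h_ω(f + v) - h_ω(v)` (path independence, Def. 2.3).
[cite: DKLM2026SixVertexGFF, Def. 2.3] -/
theorem heightAt_shift (ω : Config (ℤ × ℤ)) (hice : ∀ w, IceRuleAt ω w) (v f : ℤ × ℤ) :
    heightAt (fun w => ω (w + v)) f = heightAt ω (f + v) - heightAt ω v := by
  rw [heightAt_sub_heightAt ω hice v (f + v)]
  have e1 : zsumIco (fun x => eastStep ω (x + v.1) v.2) 0 f.1 =
      zsumIco (fun x => eastStep ω x v.2) (0 + v.1) (f.1 + v.1) :=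
    zsumIco_comp_add (fun x => eastStep ω x v.2) v.1 0 f.1
  have e2 : zsumIco (fun y => northStep ω (f.1 + v.1) (y + v.2)) 0 f.2 =
      zsumIco (fun y => northStep ω (f.1 + v.1) y) (0 + v.2) (f.2 + v.2) :=
    zsumIco_comp_add (fun y => northStep ω (f.1 + v.1) y) v.2 0 f.2
  unfold heightAt
  simp only [eastStep_shift, northStep_shift, zero_add, Prod.fst_add, Prod.snd_add]
  rw [zero_add] at e1 e2
  rw [e1, e2]

/-- Floors commute with lattice translations: the face of `z + v` is the face of `z` shifted
by `v`. [folklore] -/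
theorem floor_add_latticeVector (z : ℂ) (v : ℤ × ℤ) :
    (⌊(z + ((v.1 : ℂ) + (v.2 : ℂ) * Complex.I)).re⌋, ⌊(z + ((v.1 : ℂ) + (v.2 : ℂ) * Complex.I)).im⌋) =
      (⌊z.re⌋, ⌊z.im⌋) + v := by
  ext
  · simp only [Complex.add_re, Complex.mul_re, Complex.intCast_re, Complex.intCast_im,
      Complex.I_re, Complex.I_im, mul_zero, zero_mul, sub_zero, add_zero, Prod.fst_add,
      Int.floor_add_intCast]
  · simp only [Complex.add_im, Complex.mul_im, Complex.intCast_re, Complex.intCast_im,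
      Complex.I_re, Complex.I_im, mul_zero, mul_one, zero_add, add_zero, Prod.snd_add,
      Int.floor_add_intCast]

/-- Height differences of the translated arguments are height differences of the translated
configuration (ice configurations). [cite: DKLM2026SixVertexGFF, Def. 2.3] -/
theorem heightPlane_add_latticeVector_sub (ω : Config (ℤ × ℤ)) (hice : ∀ w, IceRuleAt ω w)
    (v : ℤ × ℤ) (z z' : ℂ) :
    heightPlane ω (z' + ((v.1 : ℂ) + (v.2 : ℂ) * Complex.I)) -
        heightPlane ω (z + ((v.1 : ℂ) + (v.2 : ℂ) * Complex.I)) =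
      heightPlane (fun w => ω (w + v)) z' - heightPlane (fun w => ω (w + v)) z := by
  unfold heightPlane
  rw [floor_add_latticeVector, floor_add_latticeVector, heightAt_shift ω hice, heightAt_shift ω hice]
  ring

/-- **Lattice-translation invariance of the `k`-point functions**: `Φ_k(u + v) = Φ_k(u)` for
every `v ∈ ℤ²`, every `k` and every planar slope-zero six-vertex measure (translation
invariance of `ℙ_{ℤ²}`, Thm. 2.2, and the `P`-a.s. ice rule). [cite: DKLM2026SixVertexGFF, Def. 2.4 and Thm. 2.2] -/
theorem IsPlanarSixVertexMeasure.kPoint_add_latticeVector {a b c : ℝ}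
    {P : Measure (Config (ℤ × ℤ))} (hP : IsPlanarSixVertexMeasure a b c P) {k : ℕ}
    (u : Fin k → ℂ × ℂ) (v : ℤ × ℤ) :
    kPoint P k (fun i => ((u i).1 + ((v.1 : ℂ) + (v.2 : ℂ) * Complex.I),
      (u i).2 + ((v.1 : ℂ) + (v.2 : ℂ) * Complex.I))) = kPoint P k u := by
  unfold kPoint
  rw [← hP.integral_shift_eq v
    (fun ω => ∏ i, ((heightPlane ω (u i).2 : ℝ) - (heightPlane ω (u i).1 : ℝ)))]
  refine integral_congr_ae ?_
  filter_upwards [hP.ae_iceRuleAt] with ω hice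
  refine Finset.prod_congr rfl fun i _ => ?_
  have h := heightPlane_add_latticeVector_sub ω hice v (u i).1 (u i).2
  have h' : ((heightPlane ω ((u i).2 + ((v.1 : ℂ) + (v.2 : ℂ) * Complex.I)) : ℤ) : ℝ) -
      ((heightPlane ω ((u i).1 + ((v.1 : ℂ) + (v.2 : ℂ) * Complex.I)) : ℤ) : ℝ) =
      ((heightPlane (fun w => ω (w + v)) (u i).2 : ℤ) : ℝ) -
        ((heightPlane (fun w => ω (w + v)) (u i).1 : ℤ) : ℝ) := by
    exact_mod_cast h
  exact h'

/-- The scaled `k`-point functions are invariant under translations by `δ ℤ²`: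
`Φ_k^{(δ)}(u + δ v) = Φ_k^{(δ)}(u)`. [cite: DKLM2026SixVertexGFF, Def. 2.4 and Thm. 2.2] -/
theorem IsPlanarSixVertexMeasure.kPointScaled_add_latticeVector {a b c : ℝ}
    {P : Measure (Config (ℤ × ℤ))} (hP : IsPlanarSixVertexMeasure a b c P) {k : ℕ} {δ : ℝ}
    (hδ : δ ≠ 0) (u : Fin k → ℂ × ℂ) (v : ℤ × ℤ) :
    kPointScaled P k δ (fun i => ((u i).1 + δ * ((v.1 : ℂ) + (v.2 : ℂ) * Complex.I),
      (u i).2 + δ * ((v.1 : ℂ) + (v.2 : ℂ) * Complex.I))) = kPointScaled P k δ u := by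
  unfold kPointScaled
  have hδ' : (δ : ℂ) ≠ 0 := by exact_mod_cast hδ
  have e : ∀ z : ℂ, (z + δ * ((v.1 : ℂ) + (v.2 : ℂ) * Complex.I)) / δ =
      z / δ + ((v.1 : ℂ) + (v.2 : ℂ) * Complex.I) := by
    intro z
    field_simp
  simp only [e]
  exact hP.kPoint_add_latticeVector (fun i => ((u i).1 / δ, (u i).2 / δ)) v

end Literature.Probability.LatticeModels.SixVertex

end
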